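import Mathlib
import Literature.Analysis.FluidPDE.WholeSpaceIBP
import Summits.AnomalousDissipation.AnomalousDissipation.Theorems.DyadicWallCascadeHalfSpaceHierarchyCurlOfDegreeZeroField
import Summits.AnomalousDissipation.AnomalousDissipation.Theorems.DyadicWallCascadeHalfSpaceHierarchySlabExtension
import HarnessLib

/-!
# Weyl-type tools for the rate obstruction `NoFastBlowDown` (Tools C2)

Tools file C2 of the unconditional rate obstruction `NoFastBlowDown` for the witnesses of the crux
`Summit.AnomalousDissipation.AnomalousDissipation.Theses.DyadicWallCascade.ViscousContinuation`
(stmt-AnomalousDissipation-17917, line SketchIdeator4, lead c1).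

The tested-momentum argument of the rate obstruction produces, for a globally smooth field
`U : ℝ³ → ℝ³` (`ℝ³ = EuclideanSpace ℝ (Fin 3)`, height coordinate `X 2`), the relations
`∫ Δφ · Uᵢ = 0` for all smooth `φ` compactly supported in an open horizontal slab
`{a < X 2 < b}`.  This file supplies the folklore tools turning this into pointwise harmonicity
and handling the smooth cut-off extensions of the hierarchy:

* `noFastBlowDown_weyl_harmonic` — smooth weakly-harmonic fields are harmonic on the slab,
  written as `Σᵢ ∂ᵢ∂ᵢ U = 0` (Green's identity twice, tree lemma
  `Literature.Analysis.FluidPDE.integral_inner_laplacian_add_eq_zero`, then a bump-function test);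
* `noFastBlowDown_weyl_cutoff_smul`, `noFastBlowDown_weyl_cutoff_mul` — `X ↦ θ(X 2) • f X` is
  smooth on `ℝ³` when `θ` is smooth and vanishes on `(-∞, δ]` (`δ > 0`) and `f` is smooth on the
  open half-space `{0 < X 2}`;
* `noFastBlowDown_weyl_plateau` — a smooth plateau profile `θ = 0` on `t ≤ 1/4`, `θ = 1` on
  `t ≥ 1/2`, `0 ≤ θ ≤ 1` (`θ t = Real.smoothTransition (4 t - 1)`);
* `noFastBlowDown_weyl_fderiv_congr` — fields agreeing on the open slab have the same first and
  (pure) second derivatives there.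

All statements are folklore calculus (the openness of the slab and of the half-space is reused from
the tree: `HalfSpaceHierarchy.slabExt_isOpen_band`, `HalfSpaceHierarchy.isOpen_halfSpace_coord_two_pos`);
the file ends with the registered tools stub `stub_noFastBlowDownWeylTools` (conjunction of the
five statements).
-/

open MeasureTheory Set Filter Topology Function Metric
open Literature.Analysis.FluidPDE
open scoped Laplacian RealInnerProductSpace ContDiff

set_option linter.dupNamespace false

noncomputable section

namespace Summit.AnomalousDissipation.AnomalousDissipation.Theorems

/-! ## Derivative congruence on the open slab -/

/-- **Derivative congruence on the open slab.** If two fields `U`, `V` on `ℝ³` agree on the open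
slab `{a < X 2 < b}`, then at every point of the slab their Fréchet derivatives agree, and so do
the derivatives of their partial derivatives `Y ↦ DU(Y) eᵢ`, `Y ↦ DV(Y) eᵢ` (derivatives are
local). [folklore] -/
theorem noFastBlowDown_weyl_fderiv_congr
    (U V : EuclideanSpace ℝ (Fin 3) → EuclideanSpace ℝ (Fin 3)) (a b : ℝ)
    (hUV : ∀ X : EuclideanSpace ℝ (Fin 3), a < X 2 → X 2 < b → U X = V X)
    (X : EuclideanSpace ℝ (Fin 3)) (ha : a < X 2) (hb : X 2 < b) :
    fderiv ℝ U X = fderiv ℝ V X ∧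
      ∀ i : Fin 3, fderiv ℝ (fun Y => fderiv ℝ U Y (EuclideanSpace.single i (1 : ℝ))) X =
        fderiv ℝ (fun Y => fderiv ℝ V Y (EuclideanSpace.single i (1 : ℝ))) X := by
  have hO := HalfSpaceHierarchy.slabExt_isOpen_band a b
  have hev : ∀ Y : EuclideanSpace ℝ (Fin 3), a < Y 2 → Y 2 < b → U =ᶠ[𝓝 Y] V :=
    fun Y h1 h2 => Filter.eventuallyEq_of_mem (hO.mem_nhds ⟨h1, h2⟩) fun Z hZ => hUV Z hZ.1 hZ.2
  refine ⟨(hev X ha hb).fderiv_eq, fun i => Filter.EventuallyEq.fderiv_eq ?_⟩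
  filter_upwards [hO.mem_nhds ⟨ha, hb⟩] with Z hZ
  rw [(hev Z hZ.1 hZ.2).fderiv_eq]

/-! ## The plateau profile -/

/-- **A smooth plateau profile.** There is a smooth `θ : ℝ → ℝ` with `θ = 0` on `t ≤ 1/4`,
`θ = 1` on `t ≥ 1/2` and `0 ≤ θ ≤ 1` everywhere: `θ t = S (4 t - 1)` with
`S = Real.smoothTransition`. [folklore] -/
theorem noFastBlowDown_weyl_plateau :
    ∃ θ : ℝ → ℝ, ContDiff ℝ ((⊤ : ℕ∞) : WithTop ℕ∞) θ ∧ (∀ t, t ≤ 1 / 4 → θ t = 0) ∧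
      (∀ t, 1 / 2 ≤ t → θ t = 1) ∧ (∀ t, 0 ≤ θ t ∧ θ t ≤ 1) := by
  refine ⟨fun t => Real.smoothTransition (4 * t - 1), ?_, ?_, ?_, ?_⟩
  · exact Real.smoothTransition.contDiff.comp
      ((contDiff_const.mul contDiff_id).sub contDiff_const)
  · intro t ht
    exact Real.smoothTransition.zero_of_nonpos (by linarith)
  · intro t ht
    exact Real.smoothTransition.one_of_one_le (by linarith)
  · exact fun t => ⟨Real.smoothTransition.nonneg _, Real.smoothTransition.le_one _⟩

/-! ## Smooth cut-off extensions from the open half-space -/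

/-- **Smooth cut-off extension (vector-valued).** If `θ : ℝ → ℝ` is smooth and vanishes on
`t ≤ δ` for some `δ > 0`, and `f` is smooth on the open half-space `{0 < X 2}` (arbitrary
elsewhere), then `X ↦ θ(X 2) • f X` is smooth on all of `ℝ³`: near a point with `X 2 > 0` it is
a product of smooth maps, and near a point with `X 2 ≤ 0` it vanishes identically on the open
set `{Y 2 < δ}`. [folklore] -/
theorem noFastBlowDown_weyl_cutoff_smul {F : Type*} [NormedAddCommGroup F] [NormedSpace ℝ F]
    (θ : ℝ → ℝ) (f : EuclideanSpace ℝ (Fin 3) → F) (δ : ℝ) (hδ : 0 < δ)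
    (hθ : ContDiff ℝ ((⊤ : ℕ∞) : WithTop ℕ∞) θ) (hθ0 : ∀ t, t ≤ δ → θ t = 0)
    (hf : ContDiffOn ℝ ((⊤ : ℕ∞) : WithTop ℕ∞) f {X : EuclideanSpace ℝ (Fin 3) | 0 < X 2}) :
    ContDiff ℝ ((⊤ : ℕ∞) : WithTop ℕ∞)
      (fun X : EuclideanSpace ℝ (Fin 3) => θ (X 2) • f X) := by
  have hθc : ContDiff ℝ ((⊤ : ℕ∞) : WithTop ℕ∞)
      (fun X : EuclideanSpace ℝ (Fin 3) => θ (X 2)) :=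
    hθ.comp (contDiff_piLp_apply (p := 2) (i := (2 : Fin 3)))
  have hopen' : IsOpen {X : EuclideanSpace ℝ (Fin 3) | X 2 < δ} :=
    isOpen_lt (PiLp.continuous_apply 2 (fun _ : Fin 3 => ℝ) (2 : Fin 3)) continuous_const
  refine contDiff_iff_contDiffAt.2 fun X => ?_
  by_cases hX : 0 < X 2
  · exact hθc.contDiffAt.smul (hf.contDiffAt
      (HalfSpaceHierarchy.isOpen_halfSpace_coord_two_pos.mem_nhds hX))
  · have hXδ : X 2 < δ := (not_lt.1 hX).trans_lt hδ
    refine (contDiffAt_const (c := (0 : F))).congr_of_eventuallyEq ?_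
    filter_upwards [hopen'.mem_nhds hXδ] with Y hY
    have hY' : Y 2 < δ := hY
    simp [hθ0 _ hY'.le]

/-- **Smooth cut-off extension (scalar-valued).** Real-valued case of
`noFastBlowDown_weyl_cutoff_smul`: `X ↦ θ(X 2) * f X` is smooth on `ℝ³`. [folklore] -/
theorem noFastBlowDown_weyl_cutoff_mul
    (θ : ℝ → ℝ) (f : EuclideanSpace ℝ (Fin 3) → ℝ) (δ : ℝ) (hδ : 0 < δ)
    (hθ : ContDiff ℝ ((⊤ : ℕ∞) : WithTop ℕ∞) θ) (hθ0 : ∀ t, t ≤ δ → θ t = 0)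
    (hf : ContDiffOn ℝ ((⊤ : ℕ∞) : WithTop ℕ∞) f {X : EuclideanSpace ℝ (Fin 3) | 0 < X 2}) :
    ContDiff ℝ ((⊤ : ℕ∞) : WithTop ℕ∞)
      (fun X : EuclideanSpace ℝ (Fin 3) => θ (X 2) * f X) :=
  noFastBlowDown_weyl_cutoff_smul θ f δ hδ hθ hθ0 hf

/-! ## Smooth weakly-harmonic fields are harmonic -/

/-- Partial derivatives `Y ↦ Dv(Y) e` of a smooth map on `ℝ³` are smooth. [folklore] -/
theorem noFastBlowDown_weyl_contDiff_fderiv_apply {F : Type*} [NormedAddCommGroup F]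
    [NormedSpace ℝ F] {v : EuclideanSpace ℝ (Fin 3) → F}
    (hv : ContDiff ℝ ((⊤ : ℕ∞) : WithTop ℕ∞) v) (e : EuclideanSpace ℝ (Fin 3)) :
    ContDiff ℝ ((⊤ : ℕ∞) : WithTop ℕ∞) fun Y => fderiv ℝ v Y e :=
  (contDiff_infty_iff_fderiv.1 hv).2.clm_apply contDiff_const

/-- The Laplacian of a smooth scalar function on `ℝ³` is smooth (it is the sum of the pure
second partial derivatives along the standard basis). [folklore] -/
theorem noFastBlowDown_weyl_contDiff_laplacian {v : EuclideanSpace ℝ (Fin 3) → ℝ}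
    (hv : ContDiff ℝ ((⊤ : ℕ∞) : WithTop ℕ∞) v) :
    ContDiff ℝ ((⊤ : ℕ∞) : WithTop ℕ∞) (Δ v) := by
  have h : Δ v = fun x => ∑ i, fderiv ℝ (fun y => fderiv ℝ v y
      (EuclideanSpace.basisFun (Fin 3) ℝ i)) x (EuclideanSpace.basisFun (Fin 3) ℝ i) :=
    funext (laplacian_eq_sum_fderiv_fderiv _ (contDiff_infty.1 hv 2))
  rw [h]
  exact ContDiff.sum fun i _ =>
    noFastBlowDown_weyl_contDiff_fderiv_apply (noFastBlowDown_weyl_contDiff_fderiv_apply hv _) _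

/-- **Green's identity twice.** For `C²` scalar functions `φ`, `w` on `ℝ³` with `φ` compactly
supported, `∫ φ Δw = ∫ (Δφ) w` (two applications of
`∫ ⟪Δv, w⟫ + Σᵢ ∫ ⟪∂ᵢv, ∂ᵢw⟫ = 0`). [folklore] -/
theorem noFastBlowDown_weyl_green_twice {φ w : EuclideanSpace ℝ (Fin 3) → ℝ}
    (hφ : ContDiff ℝ 2 φ) (hw : ContDiff ℝ 2 w) (hφc : HasCompactSupport φ) :
    ∫ Y, φ Y * (Δ w) Y = ∫ Y, (Δ φ) Y * w Y := by
  set b := EuclideanSpace.basisFun (Fin 3) ℝ with hb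
  have h1 := integral_inner_laplacian_add_eq_zero b hφ (hw.of_le one_le_two) (Or.inl hφc)
  have h2 := integral_inner_laplacian_add_eq_zero b hw (hφ.of_le one_le_two) (Or.inr hφc)
  have hx : ∀ i, ∫ x, ⟪fderiv ℝ φ x (b i), fderiv ℝ w x (b i)⟫ =
      ∫ x, ⟪fderiv ℝ w x (b i), fderiv ℝ φ x (b i)⟫ :=
    fun i => integral_congr_ae (Eventually.of_forall fun x => real_inner_comm _ _)
  simp only [hx] at h1
  have h3 : ∫ x, ⟪(Δ w) x, φ x⟫ = ∫ x, ⟪(Δ φ) x, w x⟫ := by linarith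
  simpa only [RCLike.inner_apply, conj_trivial, mul_comm] using h3

/-- **Bump-function test.** If `G` is smooth on `ℝ³` and `∫ φ G = 0` for every smooth `φ`
compactly supported in an open set `S`, then `G = 0` on `S`: test with `φ = g G` for a smooth
bump `g` centred at the point and supported in `S`, so that `∫ g G² = 0` with a continuous
nonnegative integrand equal to `G²` at the centre. [folklore] -/
theorem noFastBlowDown_weyl_bump_test {G : EuclideanSpace ℝ (Fin 3) → ℝ}
    (hG : ContDiff ℝ ((⊤ : ℕ∞) : WithTop ℕ∞) G) {S : Set (EuclideanSpace ℝ (Fin 3))}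
    (hS : IsOpen S)
    (h : ∀ φ : EuclideanSpace ℝ (Fin 3) → ℝ, ContDiff ℝ ((⊤ : ℕ∞) : WithTop ℕ∞) φ →
      HasCompactSupport φ → tsupport φ ⊆ S → ∫ Y, φ Y * G Y = 0)
    {X : EuclideanSpace ℝ (Fin 3)} (hX : X ∈ S) : G X = 0 := by
  obtain ⟨r, hr, hrS⟩ := Metric.isOpen_iff.1 hS X hX
  let g : ContDiffBump X := ⟨r / 4, r / 2, by positivity, by linarith⟩
  have hgs : tsupport (g : EuclideanSpace ℝ (Fin 3) → ℝ) ⊆ S := by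
    rw [g.tsupport_eq]
    exact (closedBall_subset_ball (by show r / 2 < r; linarith)).trans hrS
  set F : EuclideanSpace ℝ (Fin 3) → ℝ := fun Y => g Y * G Y * G Y with hF
  have hFi : ∫ Y, F Y = 0 :=
    h (fun Y => g Y * G Y) (g.contDiff.mul hG) g.hasCompactSupport.mul_right
      (tsupport_mul_subset_left.trans hgs)
  have hFc : Continuous F := (g.continuous.mul hG.continuous).mul hG.continuous
  have hFs : HasCompactSupport F := g.hasCompactSupport.mul_right.mul_right
  have hF0 : 0 ≤ F := fun Y => by
    show 0 ≤ g Y * G Y * G Y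
    rw [mul_assoc]
    exact mul_nonneg g.nonneg (mul_self_nonneg _)
  have hg1 : g X = 1 := g.one_of_mem_closedBall (mem_closedBall_self g.rIn_pos.le)
  by_contra hGX
  have hFX : F X ≠ 0 := by
    show g X * G X * G X ≠ 0
    rw [hg1, one_mul]
    exact mul_self_ne_zero.2 hGX
  exact (hFc.integral_pos_of_hasCompactSupport_nonneg_nonzero hFs hF0 hFX).ne' hFi

/-- **Smooth weakly-harmonic fields are harmonic (Weyl, smooth case).** Let `U : ℝ³ → ℝ³` be
smooth and suppose `∫ Δφ · Uᵢ = 0` for every coordinate `i` and every smooth `φ` compactly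
supported in the open slab `{a < X 2 < b}`.  Then `Σᵢ ∂ᵢ∂ᵢ U = 0` at every point of the slab:
by Green's identity twice `∫ φ ΔUᵢ = 0` for all such `φ`, the bump-function test gives
`ΔUᵢ = 0` on the slab, and `Σᵢ ∂ᵢ∂ᵢ U = ΔU` has coordinates `ΔUᵢ`. [folklore] -/
theorem noFastBlowDown_weyl_harmonic
    (U : EuclideanSpace ℝ (Fin 3) → EuclideanSpace ℝ (Fin 3)) (a b : ℝ)
    (hU : ContDiff ℝ ((⊤ : ℕ∞) : WithTop ℕ∞) U)
    (h : ∀ (φ : EuclideanSpace ℝ (Fin 3) → ℝ) (i : Fin 3),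
      ContDiff ℝ ((⊤ : ℕ∞) : WithTop ℕ∞) φ → HasCompactSupport φ →
      tsupport φ ⊆ {X : EuclideanSpace ℝ (Fin 3) | a < X 2 ∧ X 2 < b} →
      ∫ Y, Laplacian.laplacian φ Y * (U Y) i = 0)
    (X : EuclideanSpace ℝ (Fin 3)) (ha : a < X 2) (hb : X 2 < b) :
    ∑ i : Fin 3, fderiv ℝ (fun Y => fderiv ℝ U Y (EuclideanSpace.single i (1 : ℝ))) X
      (EuclideanSpace.single i (1 : ℝ)) = 0 := by
  -- the scalar components `Uⱼ = ⟪U, eⱼ⟫` are smooth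
  have hUj : ∀ j : Fin 3, ContDiff ℝ ((⊤ : ℕ∞) : WithTop ℕ∞) fun Y => U Y j :=
    fun j => contDiff_euclidean.1 hU j
  -- Step 1: `Δ Uⱼ (X) = 0` for each `j`
  have hΔj : ∀ j : Fin 3, (Δ (fun Y => U Y j)) X = 0 := by
    intro j
    refine noFastBlowDown_weyl_bump_test (noFastBlowDown_weyl_contDiff_laplacian (hUj j))
      (HalfSpaceHierarchy.slabExt_isOpen_band a b) (fun φ hφ hφc hφs => ?_) ⟨ha, hb⟩
    rw [noFastBlowDown_weyl_green_twice (contDiff_infty.1 hφ 2)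
      (contDiff_infty.1 (hUj j) 2) hφc]
    exact h φ j hφ hφc hφs
  -- Step 2: `Σᵢ ∂ᵢ∂ᵢ U (X) = Δ U (X)` and `(Δ U (X))ⱼ = Δ Uⱼ (X)`
  have hU2 : ContDiff ℝ 2 U := contDiff_infty.1 hU 2
  have hsum : ∑ i : Fin 3, fderiv ℝ (fun Y => fderiv ℝ U Y (EuclideanSpace.single i (1 : ℝ))) X
      (EuclideanSpace.single i (1 : ℝ)) = (Δ U) X := by
    rw [laplacian_eq_sum_fderiv_fderiv (EuclideanSpace.basisFun (Fin 3) ℝ) hU2 X]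
    simp only [EuclideanSpace.basisFun_apply]
  rw [hsum]
  refine PiLp.ext fun j => ?_
  have hcomp : (Δ (fun Y => U Y j)) X = ((Δ U) X) j := by
    have := (hU2.contDiffAt (x := X)).laplacian_CLM_comp_left (l := EuclideanSpace.proj j)
    simpa [Function.comp_def] using this
  rw [PiLp.zero_apply, ← hcomp, hΔj j]

/-! ## The registered tools stub -/

/-- **Tools C2 of the rate obstruction (registered stub).** Conjunction of the five folklore
Weyl-type tools: smooth weakly-harmonic fields on an open slab are harmonic there
(`Σᵢ ∂ᵢ∂ᵢ U = 0`); smooth slab cut-off extensions of fields smooth on the open half-space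
(vector- and scalar-valued); a smooth plateau profile; and congruence of first and second
derivatives for fields agreeing on the open slab. [folklore] -/
theorem stub_noFastBlowDownWeylTools :
    (∀ (U : EuclideanSpace ℝ (Fin 3) → EuclideanSpace ℝ (Fin 3)) (a b : ℝ),
      ContDiff ℝ ((⊤ : ℕ∞) : WithTop ℕ∞) U →
      (∀ (φ : EuclideanSpace ℝ (Fin 3) → ℝ) (i : Fin 3), ContDiff ℝ ((⊤ : ℕ∞) : WithTop ℕ∞) φ →
        HasCompactSupport φ → tsupport φ ⊆ {X : EuclideanSpace ℝ (Fin 3) | a < X 2 ∧ X 2 < b} →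
        ∫ Y, Laplacian.laplacian φ Y * (U Y) i = 0) →
      ∀ X : EuclideanSpace ℝ (Fin 3), a < X 2 → X 2 < b →
        ∑ i : Fin 3, fderiv ℝ (fun Y => fderiv ℝ U Y (EuclideanSpace.single i (1 : ℝ))) X
          (EuclideanSpace.single i (1 : ℝ)) = 0) ∧
    (∀ (θ : ℝ → ℝ) (f : EuclideanSpace ℝ (Fin 3) → EuclideanSpace ℝ (Fin 3)) (δ : ℝ), 0 < δ →
      ContDiff ℝ ((⊤ : ℕ∞) : WithTop ℕ∞) θ → (∀ t, t ≤ δ → θ t = 0) →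
      ContDiffOn ℝ ((⊤ : ℕ∞) : WithTop ℕ∞) f {X : EuclideanSpace ℝ (Fin 3) | 0 < X 2} →
      ContDiff ℝ ((⊤ : ℕ∞) : WithTop ℕ∞) (fun X : EuclideanSpace ℝ (Fin 3) => θ (X 2) • f X)) ∧
    (∀ (θ : ℝ → ℝ) (f : EuclideanSpace ℝ (Fin 3) → ℝ) (δ : ℝ), 0 < δ →
      ContDiff ℝ ((⊤ : ℕ∞) : WithTop ℕ∞) θ → (∀ t, t ≤ δ → θ t = 0) →
      ContDiffOn ℝ ((⊤ : ℕ∞) : WithTop ℕ∞) f {X : EuclideanSpace ℝ (Fin 3) | 0 < X 2} →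
      ContDiff ℝ ((⊤ : ℕ∞) : WithTop ℕ∞) (fun X : EuclideanSpace ℝ (Fin 3) => θ (X 2) * f X)) ∧
    (∃ θ : ℝ → ℝ, ContDiff ℝ ((⊤ : ℕ∞) : WithTop ℕ∞) θ ∧ (∀ t, t ≤ 1 / 4 → θ t = 0) ∧
      (∀ t, 1 / 2 ≤ t → θ t = 1) ∧ (∀ t, 0 ≤ θ t ∧ θ t ≤ 1)) ∧
    (∀ (U V : EuclideanSpace ℝ (Fin 3) → EuclideanSpace ℝ (Fin 3)) (a b : ℝ),
      (∀ X : EuclideanSpace ℝ (Fin 3), a < X 2 → X 2 < b → U X = V X) →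
      ∀ X : EuclideanSpace ℝ (Fin 3), a < X 2 → X 2 < b →
        fderiv ℝ U X = fderiv ℝ V X ∧
        ∀ i : Fin 3, fderiv ℝ (fun Y => fderiv ℝ U Y (EuclideanSpace.single i (1 : ℝ))) X =
          fderiv ℝ (fun Y => fderiv ℝ V Y (EuclideanSpace.single i (1 : ℝ))) X) :=
  ⟨noFastBlowDown_weyl_harmonic, noFastBlowDown_weyl_cutoff_smul, noFastBlowDown_weyl_cutoff_mul,
    noFastBlowDown_weyl_plateau, noFastBlowDown_weyl_fderiv_congr⟩

end Summit.AnomalousDissipation.AnomalousDissipation.Theorems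

end
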